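import Literature.AlgebraicGeometry.Limits.LocalizationRelativeHomSpread
import Literature.AlgebraicGeometry.Limits.FiniteLocallyFreeDescent
import Literature.AlgebraicGeometry.Limits.RankOnePullbackDense
import HarnessLib

/-!
# A finite locally free module on the GENERIC base change of a stage object spreads to a FINER STAGE ([StacksProject] Tag 0B8W (1) RELATIVE to the
# base `P ⊗ D(t)`; [EGAIV3] Thm. 8.5.2 ∕ Cor. 8.5.5); rank one is kept over a flat object ([EGAIV3] 11.10.5)

Topic `Literature/AlgebraicGeometry/Limits`; namespace `Literature.AlgebraicGeometry.Limits.LocApprox` (the series `LocalizationDiagram` … `LocalizationRelativeHomSpread`).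
THEOREMS ONLY (no definition, no named fact, no instance, no notation, no `sorry`).  Cell `hodgecm-mathlib` (D-0151), P6 «MOD programme», L4 DUALS road, organ
**(O4-β)** of the stage Mumford-bundle package (LEAD F0P6-plan (g3) «M-55c»; LA4-plan (g0) DEAL v3∕v4; LA4-p05 (g0)): the SPREAD of the generic Mumford bundle
`L^Δ(λ_E)` (rank one on `(𝒜ₜ)_K`) to a rank-one module on a stage restriction `𝒜ₜ|ₛ`, feeding ★ O4-γ `RankOneAmpleClassSpreadStage`, ★ O4-δ
`KOfLKilledOnFiniteAffineCharts`, ★ O4-ε `RankOneLocalEmbeddingSpreadDedekind` and the letter `DualPairOfAmpleRigidified`.  HC_CM is proved only modulo the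
printed citations until rung 0 closes; this file is general scheme theory and changes no count.

SETTING (★ `LocalizationRelativeGroupSpread`): `B = A_S`, `P → Spec A` quasi-compact quasi-separated, a stage `t`, the relative base `(P ⊗ D(t)).left` with its
finer stages `stageOver ρ` (`ρ : s ⟶ t`) and generic base `genOver t`, the relative leg `relLeg ρ : genOver t ⟶ stageOver ρ`; for `Y : Over (P ⊗ D(t)).left`
(quasi-compact quasi-separated) the restrictions `Y ⊗ stageOver ρ` and `Y ⊗ genOver t` (monoidal structure of the over category = fibre products over the base
stage) and the restriction map `(Y ◁ relLeg ρ).left : (Y ⊗ genOver t).left ⟶ (Y ⊗ stageOver ρ).left`.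

THE ARGUMENT.  Through the BRIDGE ★ `bridgeIso τ Y : (Y ⊗ overOf τ).left ≅ (Y_A ⊗ T).left` (`Y_A` = `Y` read as an `A`-scheme) the restrictions of `Y` ARE the
stages `Y_A ⊗ D(s)` of the absolute cone ★ `prodCone S B Y_A` (limit ★ `isLimitProdCone`, affine transitions, qcqs stages), compatibly with the legs (★
`whiskerLeft_left_comp_bridgeIso_hom`); so the ABSOLUTE descent ★ `FiniteLocallyFreeDescent.exists_isFiniteLocallyFree_pullback_iso` (Stacks 0B8W (1)) gives a
module on some stage `Y_A ⊗ D(i)`, restricted to a common refinement `r ≤ i, t` and carried back through the bridge.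

* §1 **`exists_stage_isFiniteLocallyFree_of_generic`** — `M` finite locally free on `(Y ⊗ genOver t).left` ⇒ `∃ ρ : s ⟶ t` and `Mₛ` finite locally free on
  `(Y ⊗ stageOver ρ).left` with `(Y ◁ relLeg ρ).left^* Mₛ ≅ M`.
* §2 **`exists_stage_hasRank_of_generic`** — `A` a domain, `K = Frac A`, the stage `P ⊗ D(t) → D(t)` flat and `Y → P ⊗ D(t)` flat: a RANK-`r` `M` spreads to a
  RANK-`r` `Mₛ` (the relative leg is quasi-compact and scheme-theoretically dominant, ★ `isSchemeTheoreticallyDominant_relLeg_left`; its base change along the flat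
  `Y|ₛ → P ⊗ D(s)` is dominant, Mathlib `IsSchemeTheoreticallyDominant.of_isPullback`; rank through a dense pull-back ★ `hasRank_of_hasRank_pullback_of_denseRange`).

## References
* [StacksProject] The Stacks Project, Tag 0B8W (Lemma 32.10.3 (1)), Tag 01ZM, Tag 01ZC.
* [EGAIV3] A. Grothendieck, J. Dieudonné, *EGA IV₃* (1966), Thm. 8.5.2, Cor. 8.5.5, Thm. 8.8.2, 11.10.5.
* [GortzWedhorn2020] U. Görtz, T. Wedhorn, *Algebraic Geometry I*, 2nd ed. (2020), Thm. 10.60, Cor. 10.64, §(4.7) Prop. 4.16, §(10.13).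
-/

set_option autoImplicit false

noncomputable section

-- `(P ⊗ T).left = pullback P.hom T.hom` etc. are `rfl` only at default transparency (as in ★ `LocalizationRelativeGroupSpread`).
set_option backward.isDefEq.respectTransparency false

universe u

open CategoryTheory CategoryTheory.Limits AlgebraicGeometry MonoidalCategory CartesianMonoidalCategory
open Literature.AlgebraicGeometry.Motives Literature.AlgebraicGeometry.Modules

namespace Literature.AlgebraicGeometry.Limits

namespace LocApprox

/-- `(Q ⊗ T').left → (Q ⊗ T).left` is the base change of `T'.left → T.left` along `(Q ⊗ T).left → T.left`, over ANY base scheme (the form of ★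
`SubalgApprox.isPullback_whiskerLeft_left`). [folklore] -/
private theorem isPullback_whiskerLeft_left_over' {X : Scheme.{u}} (Q : Over X) {T T' : Over X} (g : T' ⟶ T) :
    IsPullback (Q ◁ g).left (pullback.snd Q.hom T'.hom) (pullback.snd Q.hom T.hom) g.left := by
  refine IsPullback.of_right ?_ (Over.whiskerLeft_left_snd g) (IsPullback.of_hasPullback Q.hom T.hom)
  rw [Over.whiskerLeft_left_fst, Over.w g]
  exact IsPullback.of_hasPullback Q.hom T'.hom

/-! ## §1 Finite locally free modules spread from the generic base change to a finer stage -/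

section Spread

variable {A : Type u} [CommRing A] {S : Submonoid A} (B : Type u) [CommRing B] [Algebra A B] [IsLocalization S B]
  {P : SchemeOver A} [QuasiCompact P.hom] [QuasiSeparated P.hom] {t : Idx S}

/-- **A FINITE LOCALLY FREE MODULE ON THE GENERIC BASE CHANGE `Y ×_{P_t} (P ⊗ Spec B)` OF A QCQS STAGE OBJECT `Y` COMES FROM A FINER STAGE** ([StacksProject]
Tag 0B8W (1) relative to `P ⊗ D(t)`): there are `ρ : s ⟶ t` and a finite locally free `Mₛ` on `(Y ⊗ stageOver ρ).left = Y ×_{P_t} (P ⊗ D(s))` whose restriction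
along the relative leg `(Y ◁ relLeg ρ).left` is `M`.  Proof: bridge to the absolute cone ★ `prodCone S B Y_A` (`Y_A := (Over.map (P ⊗ D t).hom).obj Y`), ★
`exists_isFiniteLocallyFree_pullback_iso`, refine the stage below `t` (★ `exists_hom₂`), bridge back (★ `whiskerLeft_left_comp_bridgeIso_hom`).
[cite: StacksProject, Tag 0B8W (Lemma 32.10.3 (1))] [cite: EGAIV3, Thm. 8.5.2 and Cor. 8.5.5] [cite: GortzWedhorn2020, Thm. 10.60 and §(4.7) Prop. 4.16] -/
theorem exists_stage_isFiniteLocallyFree_of_generic (Y : Over (P ⊗ (baseDiagram S).obj t).left) [QuasiCompact Y.hom] [QuasiSeparated Y.hom]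
    {M : (Y ⊗ genOver S B P t).left.Modules} (hM : IsFiniteLocallyFree M) :
    ∃ (s : Idx S) (ρ : s ⟶ t) (Mₛ : (Y ⊗ stageOver S P ρ).left.Modules), IsFiniteLocallyFree Mₛ ∧
      Nonempty ((Scheme.Modules.pullback (Y ◁ relLeg S B P ρ).left).obj Mₛ ≅ M) := by
  classical
  -- `Y` as an `A`-scheme and the limit cone of its stages
  let YA : SchemeOver A := (Over.map (P ⊗ (baseDiagram S).obj t).hom).obj Y
  haveI : QuasiCompact YA.hom := quasiCompact_map_hom Y
  haveI : QuasiSeparated YA.hom := quasiSeparated_map_hom Y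
  -- the generic bridge `(Y ⊗ genOver t).left ≅ (Y_A ⊗ Spec B).left = (prodCone S B Y_A).pt`, and `M` carried over
  let eg := bridgeIso (leg S B t) Y
  let M' : (prodCone S B YA).pt.Modules := (Scheme.Modules.pullback eg.inv).obj M
  have hM' : IsFiniteLocallyFree M' := hM.pullback eg.inv
  -- absolute descent to some stage `i` (Stacks 0B8W (1))
  obtain ⟨i, ℰ, hℰ, ⟨eℰ⟩⟩ := exists_isFiniteLocallyFree_pullback_iso (prodDiagram S YA) (prodCone S B YA)
    (isLimitProdCone S B YA) hM'
  -- a common refinement `r` of `i` and `t`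
  obtain ⟨r, ⟨σ⟩, ⟨ρ⟩⟩ := exists_hom₂ S i t
  let ℰr : ((prodDiagram S YA).obj r).Modules := (Scheme.Modules.pullback ((prodDiagram S YA).map σ)).obj ℰ
  have hℰr : IsFiniteLocallyFree ℰr := hℰ.pullback _
  -- `π_r^* ℰ_r ≅ π_i^* ℰ ≅ M'`
  have er : (Scheme.Modules.pullback ((prodCone S B YA).π.app r)).obj ℰr ≅ M' :=
    (Scheme.Modules.pullbackComp ((prodCone S B YA).π.app r) ((prodDiagram S YA).map σ)).app ℰ ≪≫
      (Scheme.Modules.pullbackCongr ((prodCone S B YA).w σ)).app ℰ ≪≫ eℰ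
  -- carry `ℰ_r` through the stage bridge `(Y ⊗ stageOver ρ).left ≅ (Y_A ⊗ D(r)).left`
  let es := bridgeIso ((baseDiagram S).map ρ) Y
  refine ⟨r, ρ, (Scheme.Modules.pullback es.hom).obj ℰr, hℰr.pullback es.hom, ⟨?_⟩⟩
  -- `(Y ◁ relLeg ρ) ≫ bridge_ρ = bridge_t ≫ (Y_A ◁ leg r) = bridge_t ≫ π_r`
  have hsq : (Y ◁ relLeg S B P ρ).left ≫ es.hom = eg.hom ≫ (prodCone S B YA).π.app r :=
    whiskerLeft_left_comp_bridgeIso_hom ((baseDiagram S).map ρ) Y (leg S B r) (leg S B t) (relLeg S B P ρ) rfl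
  exact (Scheme.Modules.pullbackComp (Y ◁ relLeg S B P ρ).left es.hom).app ℰr ≪≫
    (Scheme.Modules.pullbackCongr hsq).app ℰr ≪≫
    ((Scheme.Modules.pullbackComp eg.hom ((prodCone S B YA).π.app r)).app ℰr).symm ≪≫
    (Scheme.Modules.pullback eg.hom).mapIso er ≪≫
    (Scheme.Modules.pullbackComp eg.hom eg.inv).app M ≪≫
    (Scheme.Modules.pullbackCongr eg.hom_inv_id).app M ≪≫
    (Scheme.Modules.pullbackId _).app M

end Spread

/-! ## §2 Rank is kept: over a flat stage object the relative restriction map is dominant -/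

section Rank

variable {A : Type u} [CommRing A] [IsDomain A] (K : Type u) [Field K] [Algebra A K] [IsFractionRing A K]
  {P : SchemeOver A} [QuasiCompact P.hom] [QuasiSeparated P.hom] {t : Idx (nonZeroDivisors A)}

omit [QuasiCompact P.hom] [QuasiSeparated P.hom] in
/-- **The relative restriction map `(Y ⊗ genOver t).left ⟶ (Y ⊗ stageOver ρ).left` is scheme-theoretically dominant** for `A` a domain, `K = Frac A`, the stage
`P ⊗ D(s) → D(s)` flat and `Y → P ⊗ D(t)` flat: base change (Mathlib `IsSchemeTheoreticallyDominant.of_isPullback`) of the quasi-compact dominant relative leg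
(★ `isSchemeTheoreticallyDominant_relLeg_left`) along the flat `Y|ₛ → P ⊗ D(s)`. [cite: EGAIV3, 11.10.5] [cite: GortzWedhorn2020, Prop. 9.19 and Rem. 9.20] -/
theorem isSchemeTheoreticallyDominant_whiskerLeft_relLeg_left {s : Idx (nonZeroDivisors A)} (ρ : s ⟶ t)
    [Flat (pullback.snd P.hom ((baseDiagram (nonZeroDivisors A)).obj s).hom)]
    (Y : Over (P ⊗ (baseDiagram (nonZeroDivisors A)).obj t).left) [Flat Y.hom] :
    IsSchemeTheoreticallyDominant (Y ◁ relLeg (nonZeroDivisors A) K P ρ).left := by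
  haveI : IsSchemeTheoreticallyDominant (leg (nonZeroDivisors A) K s).left :=
    Literature.NumberTheory.EllipticCurves.isSchemeTheoreticallyDominant_leg_left K s
  haveI : QuasiCompact (relLeg (nonZeroDivisors A) K P ρ).left := quasiCompact_relLeg_left (nonZeroDivisors A) K P ρ
  haveI : IsSchemeTheoreticallyDominant (relLeg (nonZeroDivisors A) K P ρ).left :=
    isSchemeTheoreticallyDominant_relLeg_left (nonZeroDivisors A) K P ρ
  haveI : Flat (pullback.snd Y.hom (stageOver (nonZeroDivisors A) P ρ).hom) := MorphismProperty.pullback_snd (P := @Flat) _ _ inferInstance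
  exact IsSchemeTheoreticallyDominant.of_isPullback (isPullback_whiskerLeft_left_over' Y (relLeg (nonZeroDivisors A) K P ρ)).flip

/-- **A RANK-`r` MODULE ON THE GENERIC BASE CHANGE OF A FLAT QCQS STAGE OBJECT SPREADS TO A RANK-`r` MODULE ON A FINER STAGE** (`A` a domain, `K = Frac A`,
the stage `P ⊗ D(t) → D(t)` flat): §1 gives a finite locally free `Mₛ` with `(Y ◁ relLeg ρ)^* Mₛ ≅ M`; its rank is `r` everywhere because the restriction map
is dominant (`isSchemeTheoreticallyDominant_whiskerLeft_relLeg_left`, Mathlib «quasi-compact scheme-theoretically dominant ⇒ dominant») and the rank of a finite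
locally free module is read on a dense set (★ `hasRank_of_hasRank_pullback_of_denseRange`).  With `Y := 𝒜ₜ.X` and `M :=` the generic Mumford bundle this is the
RANK-ONE line bundle `Lₛ` on `𝒜ₜ|ₛ` of the hodgecm DUALS road.
[cite: StacksProject, Tag 0B8W (Lemma 32.10.3 (1))] [cite: EGAIV3, Thm. 8.5.2, Cor. 8.5.5 and 11.10.5] -/
theorem exists_stage_hasRank_of_generic [Flat (pullback.snd P.hom ((baseDiagram (nonZeroDivisors A)).obj t).hom)]
    (Y : Over (P ⊗ (baseDiagram (nonZeroDivisors A)).obj t).left) [QuasiCompact Y.hom] [QuasiSeparated Y.hom] [Flat Y.hom]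
    {M : (Y ⊗ genOver (nonZeroDivisors A) K P t).left.Modules} {r : ℕ} (hM : HasRank M r) :
    ∃ (s : Idx (nonZeroDivisors A)) (ρ : s ⟶ t) (Mₛ : (Y ⊗ stageOver (nonZeroDivisors A) P ρ).left.Modules), HasRank Mₛ r ∧
      Nonempty ((Scheme.Modules.pullback (Y ◁ relLeg (nonZeroDivisors A) K P ρ).left).obj Mₛ ≅ M) := by
  obtain ⟨s, ρ, Mₛ, hMₛ, ⟨e⟩⟩ := exists_stage_isFiniteLocallyFree_of_generic K Y (HasRank.isFiniteLocallyFree' hM)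
  haveI : Flat (pullback.snd P.hom ((baseDiagram (nonZeroDivisors A)).obj s).hom) :=
    MorphismProperty.of_isPullback (SubalgApprox.isPullback_whiskerLeft_left P ((baseDiagram (nonZeroDivisors A)).map ρ)) ‹_›
  haveI := isSchemeTheoreticallyDominant_whiskerLeft_relLeg_left K ρ Y
  haveI : QuasiCompact (Y ◁ relLeg (nonZeroDivisors A) K P ρ).left := by
    haveI : QuasiCompact (relLeg (nonZeroDivisors A) K P ρ).left := quasiCompact_relLeg_left (nonZeroDivisors A) K P ρ
    exact MorphismProperty.of_isPullback (P := @QuasiCompact)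
      (isPullback_whiskerLeft_left_over' Y (relLeg (nonZeroDivisors A) K P ρ)).flip inferInstance
  have hdense : DenseRange (Y ◁ relLeg (nonZeroDivisors A) K P ρ).left.base :=
    (inferInstance : IsDominant (Y ◁ relLeg (nonZeroDivisors A) K P ρ).left).denseRange
  exact ⟨s, ρ, Mₛ, hasRank_of_hasRank_pullback_of_denseRange _ hdense hMₛ (hasRank_of_iso e.symm hM), ⟨e⟩⟩

end Rank

end LocApprox

end Literature.AlgebraicGeometry.Limits

end
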